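import Summits.BirchSwinnertonDyer.BirchSwinnertonDyer.Theorems.QuadraticBranchSignedControlEtaLayerPackages
import HarnessLib

/-!
# Base change of local Selmer conditions along `subgroupH1Iso`, file 5: the CLASSICAL Selmer group
# under `subgroupH1Iso` (both inclusions)
(cell `bsd-potss`, seat `bsd-potss-k8q-c3` g2; rung K8, route `QuadraticBranchSignedControl`, crux
`EtaTransportSigned` (stmt-BirchSwinnertonDyer-19115), child `EtaLayerComparison`
(stmt-BirchSwinnertonDyer-19583))

WHAT. **`map_subgroupH1Iso_selmerGroupOver`**: for `L/K` Galois number fields and `U ≤ Gal(K̄/L)`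
normal in `Γ_K`, `subgroupH1Iso (Sel_{p^∞}(E_L / L̄^{U^L})) = Sel_{p^∞}(E / K̄^U)` — the classical
`p^∞`-Selmer group of the SAME field `M = K̄^U = L̄^{U^L}`, its local conditions indexed by the places
of `L` and all `Γ_L`-conjugates (`(W.baseChange L).selmerGroupOver p U^L`) or by the places of `K` and
all `Γ_K`-conjugates (`W.selmerGroupOver p U`), agree under ctrl's base-change isomorphism. The
tree's ONE-WAY T-res (`ZpTower.kerH1Iso_mem_selmerGroupOver`, n1011-p17, for the layers of a
`ℤ_p`-tower) for `subgroupH1Iso`, WITH THE CONVERSE: every `K`-embedding `K̄ → K̄_v` has a package at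
some `w ∣ v` and every `L`-embedding `L̄ → L̄_w` has one at `v = w ∩ K` (file 4), and the classical
local condition is an IFF along a package (file 1).

HONEST FRAMING (cell `bsd-potss`, run/shared/lean/pub/bsd-potss/; FULL-BSD rank ≤ 1 programme):
INFRASTRUCTURE THEOREMS ONLY — no definition, no named Literature fact, no `sorry`, axioms
standard; nothing about (C1_η), Kobayashi's theorems or `BSD(W, p)` is claimed; no label or count
moves. Helper toward item 19583 (the classical half (c1) of `hLayer`).

References: [Mazur1972] §6; [GreenbergLNM1716] §2 (the places of `M` above a place of `F` and
conjugate decomposition groups); [SerreGaloisCohomology1997] II.§1.1.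
-/

set_option autoImplicit false
set_option linter.dupNamespace false

noncomputable section

open scoped Classical

open NumberField IsDedekindDomain
open Literature.NumberTheory.EllipticCurves
open Summit.BirchSwinnertonDyer.Rank1Residual.Additive
open Summit.BirchSwinnertonDyer.Rank1Residual.Additive.LocalTransport
open Summit.BirchSwinnertonDyer.Rank1Residual.Additive.BaseChange

universe u

namespace Summit.BirchSwinnertonDyer.BirchSwinnertonDyer.Theorems.EtaLayer

/-! ## §4 The classical Selmer group under `subgroupH1Iso` -/

section Selmer

open scoped NumberField.LiesOver

variable {K : Type u} [Field K] [NumberField K] (L : Type u) [Field L] [NumberField L] [Algebra K L]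
  [IsGalois K L] (W : WeierstrassCurve K) (p : ℕ)
  {U : Subgroup (Field.absoluteGaloisGroup K)} [U.Normal] (hU : U ≤ galRange (K := K) L)

/-- **Finite places, `L → K`**: for `x ∈ Sel_{p^∞}(E_L / L̄^{U^L})` and EVERY `K`-embedding
`ι : K̄ → K̄_v`, `subgroupH1Iso x` dies at `ι` (package at some `w ∣ v` + file 1's iff + the Selmer
condition of `x` at the place of `L̄^{U^L}` singled out by `ι'`). [cite: GreenbergLNM1716, §2] -/
theorem subgroupH1Iso_mem_localKerOverOfEmb_adicCompletion (v : HeightOneSpectrum (𝓞 K))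
    (ι : AlgebraicClosure K →ₐ[K] AlgebraicClosure (v.adicCompletion K))
    (x : (W.baseChange L).subgroupH1 p (comapResGal L U))
    (hx : x ∈ (W.baseChange L).selmerGroupOver p (comapResGal L U)) :
    subgroupH1Iso L W p hU x ∈ W.localKerOverOfEmb p U ι := by
  obtain ⟨w, hw, ι₂, ι', hcompat, hf, hfixL⟩ :=
    exists_package_adicCompletion L v (RingEquiv.refl _) (fun _ ↦ rfl) ι
  rw [subgroupH1Iso_mem_localKerOverOfEmb_iff L ι ι₂ ι' hcompat
    ((adicCompletionMap (K := K) L v w).comp (RingEquiv.refl (v.adicCompletion K)).symm.toRingHom)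
    hf W p hU (fun h hh ↦ hfixL h (hU hh)) x]
  obtain ⟨τ, rfl⟩ := exists_algHom_eq_comp (closureEmb (K := L) (w.adicCompletion L)) ι'
  rw [WeierstrassCurve.localKerOverOfEmb_comp, AddSubgroup.mem_comap]
  exact (((W.baseChange L).mem_selmerGroupOver_iff p (comapResGal L U) x).1 hx).1 w _

omit [NumberField K] in
/-- **Infinite places, `L → K`.** [cite: GreenbergLNM1716, §2] -/
theorem subgroupH1Iso_mem_localKerOverOfEmb_infinitePlace (v : InfinitePlace K)
    (ι : AlgebraicClosure K →ₐ[K] AlgebraicClosure v.Completion)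
    (x : (W.baseChange L).subgroupH1 p (comapResGal L U))
    (hx : x ∈ (W.baseChange L).selmerGroupOver p (comapResGal L U)) :
    subgroupH1Iso L W p hU x ∈ W.localKerOverOfEmb p U ι := by
  obtain ⟨w, hw, ι₂, ι', hcompat, hf, hfixL⟩ := exists_package_infinitePlace L v ι
  haveI : IsScalarTower K L w.Completion := isScalarTower_completion L w
  rw [subgroupH1Iso_mem_localKerOverOfEmb_iff L ι ι₂ ι' hcompat
    (LiesOver.completionMap (v := v) (w := w)) hf W p hU (fun h hh ↦ hfixL h (hU hh)) x]
  obtain ⟨τ, rfl⟩ := exists_algHom_eq_comp (closureEmb (K := L) w.Completion) ι'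
  rw [WeierstrassCurve.localKerOverOfEmb_comp, AddSubgroup.mem_comap]
  exact (((W.baseChange L).mem_selmerGroupOver_iff p (comapResGal L U) x).1 hx).2 w _

/-- **`subgroupH1Iso (Sel_{p^∞}(E_L / L̄^{U^L})) ≤ Sel_{p^∞}(E / K̄^U)`** — the T-res direction for
ctrl's `subgroupH1Iso` (every Selmer condition over `K`, at every `K`-embedding, is accounted for by
a place of `L`). [cite: Mazur1972, §6] [cite: GreenbergLNM1716, §2] -/
theorem subgroupH1Iso_mem_selmerGroupOver (x : (W.baseChange L).subgroupH1 p (comapResGal L U))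
    (hx : x ∈ (W.baseChange L).selmerGroupOver p (comapResGal L U)) :
    subgroupH1Iso L W p hU x ∈ W.selmerGroupOver p U := by
  rw [WeierstrassCurve.mem_selmerGroupOver_iff]
  refine ⟨fun v σ ↦ ?_, fun v σ ↦ ?_⟩
  · have h := subgroupH1Iso_mem_localKerOverOfEmb_adicCompletion L W p hU v
      ((closureEmb (K := K) (v.adicCompletion K)).comp
        ((show AlgebraicClosure K ≃ₐ[K] AlgebraicClosure K from σ) :
          AlgebraicClosure K →ₐ[K] AlgebraicClosure K)) x hx
    rw [W.localKerOverOfEmb_comp p U, AddSubgroup.mem_comap] at h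
    rw [WeierstrassCurve.localKerOver_eq_ofEmb]
    exact h
  · have h := subgroupH1Iso_mem_localKerOverOfEmb_infinitePlace L W p hU v
      ((closureEmb (K := K) v.Completion).comp
        ((show AlgebraicClosure K ≃ₐ[K] AlgebraicClosure K from σ) :
          AlgebraicClosure K →ₐ[K] AlgebraicClosure K)) x hx
    rw [W.localKerOverOfEmb_comp p U, AddSubgroup.mem_comap] at h
    rw [WeierstrassCurve.localKerOver_eq_ofEmb]
    exact h

/-- **Finite places, `K → L`**: if `subgroupH1Iso x ∈ Sel_{p^∞}(E / K̄^U)` then `x` dies at EVERY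
`L`-embedding `ι'₀ : L̄ → L̄_w` (package from `ι'₀` at `v = w ∩ 𝓞 K` + file 1's iff + the Selmer
condition over `K` at the `K`-embedding `ι = ι₂⁻¹ ∘ ι'₀ ∘ ι_L`). [cite: GreenbergLNM1716, §2] -/
theorem mem_localKerOverOfEmb_adicCompletion_of_subgroupH1Iso_mem (w : HeightOneSpectrum (𝓞 L))
    (ι'₀ : AlgebraicClosure L →ₐ[L] AlgebraicClosure (w.adicCompletion L))
    (x : (W.baseChange L).subgroupH1 p (comapResGal L U))
    (hx : subgroupH1Iso L W p hU x ∈ W.selmerGroupOver p U) :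
    x ∈ (W.baseChange L).localKerOverOfEmb p (comapResGal L U) ι'₀ := by
  let v : HeightOneSpectrum (𝓞 K) := w.under (𝓞 K)
  haveI : w.asIdeal.LiesOver v.asIdeal := ⟨rfl⟩
  obtain ⟨ι, ι₂, hcompat, hf, hfixL⟩ :=
    exists_package_adicCompletion_of_embedding L v (RingEquiv.refl _) (fun _ ↦ rfl) w ι'₀
  rw [← subgroupH1Iso_mem_localKerOverOfEmb_iff L ι ι₂ ι'₀ hcompat
    ((adicCompletionMap (K := K) L v w).comp (RingEquiv.refl (v.adicCompletion K)).symm.toRingHom)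
    hf W p hU (fun h hh ↦ hfixL h (hU hh)) x]
  obtain ⟨τ, rfl⟩ := exists_algHom_eq_comp (closureEmb (K := K) (v.adicCompletion K)) ι
  rw [WeierstrassCurve.localKerOverOfEmb_comp, AddSubgroup.mem_comap]
  exact ((W.mem_selmerGroupOver_iff p U _).1 hx).1 v _

/-- **Infinite places, `K → L`.** [cite: GreenbergLNM1716, §2] -/
theorem mem_localKerOverOfEmb_infinitePlace_of_subgroupH1Iso_mem (w : InfinitePlace L)
    (ι'₀ : AlgebraicClosure L →ₐ[L] AlgebraicClosure w.Completion)
    (x : (W.baseChange L).subgroupH1 p (comapResGal L U))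
    (hx : subgroupH1Iso L W p hU x ∈ W.selmerGroupOver p U) :
    x ∈ (W.baseChange L).localKerOverOfEmb p (comapResGal L U) ι'₀ := by
  let v : InfinitePlace K := w.comap (algebraMap K L)
  haveI : w.1.LiesOver v.1 := ⟨rfl⟩
  haveI : IsScalarTower K L w.Completion := isScalarTower_completion L w
  obtain ⟨ι, ι₂, hcompat, hf, hfixL⟩ := exists_package_infinitePlace_of_embedding L v w ι'₀
  rw [← subgroupH1Iso_mem_localKerOverOfEmb_iff L ι ι₂ ι'₀ hcompat
    (LiesOver.completionMap (v := v) (w := w)) hf W p hU (fun h hh ↦ hfixL h (hU hh)) x]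
  obtain ⟨τ, rfl⟩ := exists_algHom_eq_comp (closureEmb (K := K) v.Completion) ι
  rw [WeierstrassCurve.localKerOverOfEmb_comp, AddSubgroup.mem_comap]
  exact ((W.mem_selmerGroupOver_iff p U _).1 hx).2 v _

/-- **The converse inclusion**: `subgroupH1Iso x ∈ Sel_{p^∞}(E / K̄^U) → x ∈ Sel_{p^∞}(E_L / L̄^{U^L})`.
[cite: Mazur1972, §6] [cite: GreenbergLNM1716, §2] -/
theorem mem_selmerGroupOver_of_subgroupH1Iso_mem (x : (W.baseChange L).subgroupH1 p (comapResGal L U))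
    (hx : subgroupH1Iso L W p hU x ∈ W.selmerGroupOver p U) :
    x ∈ (W.baseChange L).selmerGroupOver p (comapResGal L U) := by
  rw [WeierstrassCurve.mem_selmerGroupOver_iff]
  refine ⟨fun w σ ↦ ?_, fun w σ ↦ ?_⟩
  · have h := mem_localKerOverOfEmb_adicCompletion_of_subgroupH1Iso_mem L W p hU w
      ((closureEmb (K := L) (w.adicCompletion L)).comp
        ((show AlgebraicClosure L ≃ₐ[L] AlgebraicClosure L from σ) :
          AlgebraicClosure L →ₐ[L] AlgebraicClosure L)) x hx
    rw [(W.baseChange L).localKerOverOfEmb_comp p (comapResGal L U), AddSubgroup.mem_comap] at h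
    rw [WeierstrassCurve.localKerOver_eq_ofEmb]
    exact h
  · have h := mem_localKerOverOfEmb_infinitePlace_of_subgroupH1Iso_mem L W p hU w
      ((closureEmb (K := L) w.Completion).comp
        ((show AlgebraicClosure L ≃ₐ[L] AlgebraicClosure L from σ) :
          AlgebraicClosure L →ₐ[L] AlgebraicClosure L)) x hx
    rw [(W.baseChange L).localKerOverOfEmb_comp p (comapResGal L U), AddSubgroup.mem_comap] at h
    rw [WeierstrassCurve.localKerOver_eq_ofEmb]
    exact h

/-- **`subgroupH1Iso (Sel_{p^∞}(E_L / L̄^{U^L})) = Sel_{p^∞}(E / K̄^U)`** for `L/K` Galois and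
`U ≤ Gal(K̄/L)` normal in `Γ_K`: the classical Selmer group of the field `M = K̄^U = L̄^{U^L}` computed
`Γ_L`-internally (places of `L`, all `Γ_L`-conjugates) and `Γ_K`-internally (places of `K`, all
`Γ_K`-conjugates) agree under ctrl's base-change isomorphism.
[cite: Mazur1972, §6] [cite: GreenbergLNM1716, §2] -/
theorem map_subgroupH1Iso_selmerGroupOver :
    ((W.baseChange L).selmerGroupOver p (comapResGal L U)).map
        (subgroupH1Iso L W p hU).toAddMonoidHom = W.selmerGroupOver p U := by
  ext y
  rw [AddSubgroup.mem_map]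
  constructor
  · rintro ⟨x, hx, rfl⟩
    exact subgroupH1Iso_mem_selmerGroupOver L W p hU x hx
  · intro hy
    refine ⟨(subgroupH1Iso L W p hU).symm y,
      mem_selmerGroupOver_of_subgroupH1Iso_mem L W p hU _ ?_, (subgroupH1Iso L W p hU).apply_symm_apply y⟩
    rw [AddEquiv.apply_symm_apply]
    exact hy

end Selmer

end Summit.BirchSwinnertonDyer.BirchSwinnertonDyer.Theorems.EtaLayer

end
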